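import Literature.MathematicalPhysics.QuantumFieldTheory.Balaban1983to89.Beta.RemainderKernelGreenCoercive
import Literature.MathematicalPhysics.QuantumFieldTheory.Balaban1983to89.Beta.RemainderKernelBlockAveraging

/-!
# The lattice Yukawa Green's function `(−Δ + m²)⁻¹` on `ℤ^d` decays exponentially for EVERY mass — the first concrete,
# smallness-free inhabitant of the model road's kernel letters (`Beta.RemainderKernelGreenLattice`)

statement-level skeleton of published theorems with citation tags; proofs where landed; nothing here is a claim
about the Yang–Mills mass gap.

HONEST FRAMING (cell rule).  Bookkeeping for the k-uniform remainder chain of row (D4) (`RemainderConst` ⇐ ONE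
`ChainTFac190` instance, `Beta.RemainderDecay190`); discharges NOTHING of `BetaPertH`; NOT B12 Thm 2, NOT the continuum
limit, NOT Clay.  Unit `b2b-balaban-beta-an4` gen 98 (BINDER row D4 OWNER; cell pub-balaban).  Imports
`Beta.RemainderKernelGreenCoercive` (gen 98: `exists_green_of_coercive_periodic`, `rowBound_of_hasRange`, `decay₂_mono`;
carrying `QGQInverse.form_abs_le_of_schur` ∕ `coercive_of_form_perturbation` of reader r1 and gen 9's `EntrywiseVolumeLimit`)
ONLY; nothing edited.  [folklore] — a worked instance, no new idea.

WHAT.  `T = −Δ + m²` on `ℤ^d` is given by its entries (`T(x,x) = 2d + m²`, `T(x,y) = −1` for `|x−y|₁ = 1`, `0` otherwise —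
a HYPOTHESIS `hT` on an abstract `T`, so any definition of the lattice Laplacian plugs in).  §1: an integer vector of
`ℓ¹`-length `1` is `±e_i` (`single_of_l1_eq_one`), so a site has at most `2d` nearest neighbours in any finset
(`card_filter_l1_eq_one_le`).  §2: `T` has range `1`, entries `≤ 2d + m² + 1`, is translation invariant, its
`(e^{κ|x−y|₁} − 1)`-weighted row ∕ column sums are `≤ 2d(e^κ − 1)`, and — the point — EVERY FINITE PRINCIPAL SUBMATRIX IS
`m²`-COERCIVE (**`coercive_lap`**: diagonal `(2d + m²)·1` minus the nearest-neighbour part, whose absolute row and column sums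
are `≤ 2d`, by r1's quadratic-form Schur test).  §3: **`exists_green_lap`**: for every `κ > 0` with `2d(e^κ − 1) < m²` a
two-sided inverse kernel `S` with `|S(x,y)| ≤ (m² − 2d(e^κ − 1))⁻¹ e^{−κ|x−y|₁}`, jointly `n`-periodic for every `n`;
`rate_lap`: `κ = log(1 + m²∕(4d+4))` qualifies for every `m ≠ 0`; **`exists_green_lap_every_mass`**: `∃ κ > 0, ∃ S,
T ∘ S = δ = S ∘ T ∧ Decay₂ S (2∕m²) κ ∧ ∀ n, IsPeriodic₂ n S`.  Contrast gen 97's `RemainderKernelFiniteRange.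
exists_green_nearestNeighbour`, which needed the LARGE-MASS condition `(2d + m²)⁻¹e^{δd}K₁(δ∕2) < 1`.  By gen 9's
`EntrywiseVolumeLimit.lemma222_periodic` ∕ `tendsto_torusGreen` the periodisations of `S` are the Green's functions of
`−Δ + m²` on the discrete tori `(ℤ∕s)^d` and converge entrywise to `S` — the B5 p. 36 «usual way», now with an object.
WHAT IS *NOT* DONE: `−Δ + aQ*Q` WITHOUT mass (coercive by a blockwise Poincaré inequality, not by a diagonal-dominance
count), covariant and multi-level operators, operators on averaging-constrained subspaces — i.e. Bałaban's actual
propagators; row D4 class UNCHANGED (instance 0∕1; critical-path width 0 = NODE O; D4 DISCHARGE NO DATE).  No `def`, no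
named fact, no `sorry`, standard axioms.
HONEST DEPENDENCY: continuum YM on T⁴ ⇐ BetaPertH ∧ nine spine estimates (0/9 proved); BetaPertH ⇐ (D1) ∧ (D4) ∧
CAP+tail; G-an2-4 gates asym, D1 and NE2/3/4.

Sources: [5] = T. Bałaban, Commun. Math. Phys. **95** (1984) 17–40 [Balaban1984PropagatorsI], Prop. 1.2 (1.110) p. 35
(exponential decay of the basic lattice propagators; here the zero-averaging, unit-lattice, massive special case) and p. 36;
J.-M. Combes, L. Thomas, Commun. Math. Phys. **34** (1973) 251–270 [CombesThomas1973], §II.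
-/

namespace Literature.MathematicalPhysics.QuantumFieldTheory.Balaban1983to89.Beta.RemainderKernelGreenLattice

open Literature.MathematicalPhysics.QuantumFieldTheory.Balaban1983to89
open Literature.MathematicalPhysics.QuantumFieldTheory.Balaban1983to89.B12Sec2to5 (l1 l1_nonneg abs_coord_le_l1)
open Literature.MathematicalPhysics.QuantumFieldTheory.Balaban1983to89.B12Decay510Window (l1_sub_triangle l1_sub_comm)
open Literature.MathematicalPhysics.QuantumFieldTheory.Balaban1983to89.Beta
  (Kernel₂ Decay₂ IsPeriodic₂ RowBound HasRange compKer kdelta)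
open Literature.MathematicalPhysics.QuantumFieldTheory.Balaban1983to89.QGQInverse (Coercive form_abs_le_of_schur
  coercive_of_form_perturbation)
open Literature.MathematicalPhysics.QuantumFieldTheory.Balaban1983to89.Beta.RemainderKernelGreenCoercive
  (exists_green_of_coercive_periodic rowBound_of_hasRange decay₂_mono)
open Literature.MathematicalPhysics.QuantumFieldTheory.Balaban1983to89.Beta.RemainderKernelBlockAveraging
  (single_of_l1_eq_one sum_indicator_nn_le)
open _root_.Filter
open scoped _root_.Topology

variable {d : ℕ}

/-! ## §1. Lattice vectors of `ℓ¹`-length one are `± e_i`; a site has at most `2d` nearest neighbours in any finset -/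

/-- **A site of `ℤ^d` has at most `2d` nearest neighbours** in any finset.
[cite: Balaban1984PropagatorsI, (1.110) p.35] [folklore] -/
theorem card_filter_l1_eq_one_le (x : Fin d → ℤ) (t : Finset (Fin d → ℤ)) :
    (t.filter fun y => l1 (x - y) = 1).card ≤ 2 * d := by
  classical
  set F : Fin d × Bool → (Fin d → ℤ) := fun p => x - Pi.single p.1 (if p.2 then (1 : ℤ) else -1) with hF
  have hsub : t.filter (fun y => l1 (x - y) = 1) ⊆ Finset.univ.image F := by
    intro y hy
    obtain ⟨i, hi⟩ := single_of_l1_eq_one (Finset.mem_filter.1 hy).2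
    rcases hi with h | h
    · exact Finset.mem_image.2 ⟨(i, true), Finset.mem_univ _, by simp [hF, ← h]⟩
    · exact Finset.mem_image.2 ⟨(i, false), Finset.mem_univ _, by simp [hF, ← h]⟩
  calc (t.filter fun y => l1 (x - y) = 1).card ≤ (Finset.univ.image F).card := Finset.card_le_card hsub
    _ ≤ (Finset.univ : Finset (Fin d × Bool)).card := Finset.card_image_le
    _ = 2 * d := by simp [Fintype.card_prod, Fintype.card_bool, mul_comm]

/-- Column form: `Σ_{y∈t} 1[|y−x|₁ = 1] ≤ 2d`. [cite: Balaban1984PropagatorsI, (1.110) p.35] [folklore] -/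
theorem sum_indicator_nn_le' (x : Fin d → ℤ) (t : Finset (Fin d → ℤ)) :
    ∑ y ∈ t, (if l1 (y - x) = 1 then (1 : ℝ) else 0) ≤ 2 * d := by
  simp_rw [l1_sub_comm _ x]
  exact sum_indicator_nn_le x t

/-! ## §2. The kernel of `−Δ + m²` on `ℤ^d`: range, size, translation invariance, weighted sums, coercivity `m²` -/

section Yukawa

variable {T : Kernel₂ d} {m : ℝ}

/-- `−Δ + m²` has range `1`. [cite: Balaban1984PropagatorsI, (1.110) p.35] [folklore] -/
theorem hasRange_lap (hT : ∀ x y, T x y = if x = y then 2 * d + m ^ 2 else if l1 (x - y) = 1 then -1 else 0) :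
    HasRange T 1 := by
  intro x y ⟨i, hi⟩
  have hne : x ≠ y := by
    rintro rfl; simp at hi
  have h2 : (2 : ℝ) ≤ l1 (x - y) := by
    have h2i : (2 : ℤ) ≤ |x i - y i| := by
      have : (1 : ℤ) < |x i - y i| := by exact_mod_cast hi
      omega
    have : (2 : ℝ) ≤ |((x - y) i : ℝ)| := by
      have h' : ((2 : ℤ) : ℝ) ≤ (|x i - y i| : ℤ) := by exact_mod_cast h2i
      simpa [Pi.sub_apply, Int.cast_abs] using h'
    exact this.trans (abs_coord_le_l1 (x - y) i)
  have hl : l1 (x - y) ≠ 1 := by linarith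
  rw [hT, if_neg hne, if_neg hl]

/-- `|(−Δ + m²)(x,y)| ≤ 2d + m² + 1`. [cite: Balaban1984PropagatorsI, (1.110) p.35] [folklore] -/
theorem abs_lap_le (hT : ∀ x y, T x y = if x = y then 2 * d + m ^ 2 else if l1 (x - y) = 1 then -1 else 0)
    (x y : Fin d → ℤ) : |T x y| ≤ 2 * d + m ^ 2 + 1 := by
  rw [hT]
  split_ifs
  · rw [abs_of_nonneg (by positivity)]; linarith
  · simp; positivity
  · simp; positivity

/-- `−Δ + m²` is translation invariant, hence jointly `n`-periodic for every `n`.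
[cite: Balaban1984PropagatorsI, (1.110) p.35] [folklore] -/
theorem isPeriodic₂_lap (hT : ∀ x y, T x y = if x = y then 2 * d + m ^ 2 else if l1 (x - y) = 1 then -1 else 0)
    (n : ℕ) : IsPeriodic₂ n T :=
  IsPeriodic₂.of_transInv (fun x y v => by rw [hT, hT x y]; simp [add_sub_add_right_eq_sub]) n

/-- Weighted row sums of `−Δ + m²`: `Σ_{y∈t} |T(x,y)| (e^{κ|x−y|₁} − 1) ≤ 2d (e^κ − 1)` (`κ ≥ 0`).
[cite: Balaban1984PropagatorsI, (1.110) p.35] [folklore] -/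
theorem weightedRowSum_lap_le
    (hT : ∀ x y, T x y = if x = y then 2 * d + m ^ 2 else if l1 (x - y) = 1 then -1 else 0) {κ : ℝ}
    (hκ : 0 ≤ κ) (x : Fin d → ℤ) (t : Finset (Fin d → ℤ)) :
    ∑ y ∈ t, |T x y| * (Real.exp (κ * l1 (x - y)) - 1) ≤ 2 * d * (Real.exp κ - 1) := by
  have hterm : ∀ y, |T x y| * (Real.exp (κ * l1 (x - y)) - 1)
      ≤ (Real.exp κ - 1) * (if l1 (x - y) = 1 then (1 : ℝ) else 0) := by
    intro y
    rw [hT]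
    by_cases hxy : x = y
    · subst hxy
      simp [B12Sec2to5.l1]
    · rw [if_neg hxy]
      by_cases h1 : l1 (x - y) = 1
      · rw [if_pos h1, if_pos h1, h1]; simp
      · rw [if_neg h1, if_neg h1]; simp
  calc ∑ y ∈ t, |T x y| * (Real.exp (κ * l1 (x - y)) - 1)
      ≤ ∑ y ∈ t, (Real.exp κ - 1) * (if l1 (x - y) = 1 then (1 : ℝ) else 0) := Finset.sum_le_sum fun y _ => hterm y
    _ = (Real.exp κ - 1) * ∑ y ∈ t, (if l1 (x - y) = 1 then (1 : ℝ) else 0) := by rw [Finset.mul_sum]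
    _ ≤ (Real.exp κ - 1) * (2 * d) :=
        mul_le_mul_of_nonneg_left (sum_indicator_nn_le x t) (by linarith [Real.add_one_le_exp κ])
    _ = 2 * d * (Real.exp κ - 1) := by ring

/-- Weighted column sums of `−Δ + m²` (same bound, by symmetry of the kernel).
[cite: Balaban1984PropagatorsI, (1.110) p.35] [folklore] -/
theorem weightedColSum_lap_le
    (hT : ∀ x y, T x y = if x = y then 2 * d + m ^ 2 else if l1 (x - y) = 1 then -1 else 0) {κ : ℝ}
    (hκ : 0 ≤ κ) (y : Fin d → ℤ) (t : Finset (Fin d → ℤ)) :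
    ∑ x ∈ t, |T x y| * (Real.exp (κ * l1 (x - y)) - 1) ≤ 2 * d * (Real.exp κ - 1) := by
  have hsymm : ∀ x, T x y = T y x := fun x => by
    rw [hT, hT y x, l1_sub_comm]
    by_cases h : x = y
    · subst h; rfl
    · rw [if_neg h, if_neg (Ne.symm h)]
  calc ∑ x ∈ t, |T x y| * (Real.exp (κ * l1 (x - y)) - 1)
      = ∑ x ∈ t, |T y x| * (Real.exp (κ * l1 (y - x)) - 1) :=
        Finset.sum_congr rfl fun x _ => by rw [hsymm x, l1_sub_comm]
    _ ≤ 2 * d * (Real.exp κ - 1) := weightedRowSum_lap_le hT hκ y t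

/-- **`−Δ + m²` IS `m²`-COERCIVE ON EVERY FINITE PRINCIPAL SUBMATRIX** (Dirichlet restriction): the diagonal `2d + m²`
minus a Schur bound `2d` for the nearest-neighbour part (at most `2d` neighbours, entries `−1`).
[cite: Balaban1984PropagatorsI, (1.110) p.35] [folklore] -/
theorem coercive_lap (hT : ∀ x y, T x y = if x = y then 2 * d + m ^ 2 else if l1 (x - y) = 1 then -1 else 0)
    (s : Finset (Fin d → ℤ)) : Coercive (Matrix.of fun i j : ↥s => T i j) (m ^ 2) := by
  set M : Matrix ↥s ↥s ℝ := Matrix.of fun i j : ↥s => T i j with hM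
  set D : Matrix ↥s ↥s ℝ := (2 * (d : ℝ) + m ^ 2) • (1 : Matrix ↥s ↥s ℝ) with hD
  have hDco : Coercive D (2 * d + m ^ 2) := by
    intro v
    rw [hD, Matrix.smul_mulVec, Matrix.one_mulVec, dotProduct_smul, smul_eq_mul]
  have hE : ∀ i j : ↥s, (M - D) i j = if l1 ((i : Fin d → ℤ) - (j : Fin d → ℤ)) = 1 then -1 else 0 := by
    intro i j
    rw [Matrix.sub_apply, hM, Matrix.of_apply, hT, hD, Matrix.smul_apply, Matrix.one_apply, smul_eq_mul]
    by_cases hij : i = j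
    · subst hij
      simp [B12Sec2to5.l1]
    · have hij' : (i : Fin d → ℤ) ≠ j := fun h => hij (Subtype.ext h)
      rw [if_neg hij', if_neg hij, mul_zero, sub_zero]
  have habsE : ∀ i j : ↥s, |(M - D) i j| = if l1 ((i : Fin d → ℤ) - (j : Fin d → ℤ)) = 1 then (1 : ℝ) else 0 := by
    intro i j
    rw [hE]
    split_ifs <;> simp
  have hrow : ∀ i : ↥s, ∑ j : ↥s, |(M - D) i j| ≤ 2 * d := by
    intro i
    have h := sum_indicator_nn_le (i : Fin d → ℤ) s
    rw [← Finset.sum_coe_sort s (fun y => if l1 ((i : Fin d → ℤ) - y) = 1 then (1 : ℝ) else 0)] at h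
    simpa only [habsE] using h
  have hcol : ∀ j : ↥s, ∑ i : ↥s, |(M - D) i j| ≤ 2 * d := by
    intro j
    have h := sum_indicator_nn_le' (j : Fin d → ℤ) s
    rw [← Finset.sum_coe_sort s (fun y => if l1 (y - (j : Fin d → ℤ)) = 1 then (1 : ℝ) else 0)] at h
    simpa only [habsE] using h
  have hpert : ∀ v : ↥s → ℝ, |v ⬝ᵥ ((M - D).mulVec v)| ≤ 2 * d * (v ⬝ᵥ v) :=
    form_abs_le_of_schur (M - D) (by positivity) (by rw [sq]) hrow hcol
  have h := coercive_of_form_perturbation hDco hpert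
  have e : 2 * (d : ℝ) + m ^ 2 - 2 * d = m ^ 2 := by ring
  rw [e] at h
  exact h

/-! ## §3. The lattice Yukawa Green's function `(−Δ + m²)⁻¹` on `ℤ^d` decays exponentially for EVERY mass `m > 0` -/

/-- **THE MASSIVE LATTICE GREEN'S FUNCTION, EVERY MASS.**  For `T = −Δ + m²` on `ℤ^d` and any rate `κ > 0` with
`2d (e^κ − 1) < m²`, there is a kernel `S` with `T ∘ S = δ = S ∘ T`, `|S(x,y)| ≤ (m² − 2d(e^κ − 1))⁻¹ e^{−κ|x−y|₁}`, jointly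
`n`-periodic for every `n` (so its periodisations are the torus Green's functions, `EntrywiseVolumeLimit.lemma222_periodic`).
No large-mass condition (contrast `RemainderKernelFiniteRange.exists_green_nearestNeighbour`): the smallness-free
Combes–Thomas theorem `RemainderKernelGreenCoercive.exists_green_of_coercive_periodic` with coercivity `m²` (`coercive_lap`)
and `ρ = 2d(e^κ − 1)`. [cite: Balaban1984PropagatorsI, (1.110) p.35; CombesThomas1973, §II] [folklore] -/
theorem exists_green_lap (hT : ∀ x y, T x y = if x = y then 2 * d + m ^ 2 else if l1 (x - y) = 1 then -1 else 0)
    {κ : ℝ} (hκ : 0 < κ) (hρ : 2 * d * (Real.exp κ - 1) < m ^ 2) :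
    ∃ S : Kernel₂ d, compKer T S = kdelta ∧ compKer S T = kdelta ∧
      Decay₂ S (m ^ 2 - 2 * d * (Real.exp κ - 1))⁻¹ κ ∧ ∀ n : ℕ, IsPeriodic₂ n S := by
  have hm : 0 < m ^ 2 :=
    lt_of_le_of_lt (mul_nonneg (by positivity) (by linarith [Real.add_one_le_exp κ])) hρ
  obtain ⟨S, h1, h2, h3, h4⟩ := exists_green_of_coercive_periodic (hasRange_lap hT) hρ hκ hm
    (rowBound_of_hasRange (hasRange_lap hT) (abs_lap_le hT)) (coercive_lap hT)
    (weightedRowSum_lap_le hT hκ.le) (weightedColSum_lap_le hT hκ.le)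
  exact ⟨S, h1, h2, h3, fun n => h4 n (isPeriodic₂_lap hT n)⟩

/-- A rate for every mass: `κ = log(1 + m²∕(4d + 4)) > 0` has `2d(e^κ − 1) ≤ m²∕2 < m²` (`m ≠ 0`).
[cite: Balaban1984PropagatorsI, (1.110) p.35] [folklore] -/
theorem rate_lap (hm : m ≠ 0) :
    0 < Real.log (1 + m ^ 2 / (4 * d + 4)) ∧
      2 * d * (Real.exp (Real.log (1 + m ^ 2 / (4 * d + 4))) - 1) ≤ m ^ 2 / 2 := by
  have hm2 : 0 < m ^ 2 := by positivity
  have hq : 0 < m ^ 2 / (4 * d + 4) := by positivity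
  refine ⟨Real.log_pos (by linarith), ?_⟩
  rw [Real.exp_log (by linarith), add_sub_cancel_left]
  rw [show 2 * (d : ℝ) * (m ^ 2 / (4 * d + 4)) = m ^ 2 / 2 * (2 * d / (2 * d + 2)) by field_simp; ring]
  have : 2 * (d : ℝ) / (2 * d + 2) ≤ 1 := by
    rw [div_le_one (by positivity)]; linarith
  calc m ^ 2 / 2 * (2 * d / (2 * d + 2)) ≤ m ^ 2 / 2 * 1 := mul_le_mul_of_nonneg_left this (by positivity)
    _ = m ^ 2 / 2 := mul_one _

/-- **COROLLARY — EVERY MASS**: for `T = −Δ + m²`, `m ≠ 0`, the `ℤ^d` Green's function exists, is two-sided, decays as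
`(2∕m²) e^{−κ|x−y|₁}` with `κ = log(1 + m²∕(4d+4))`, and is jointly periodic for every period. [cite: Balaban1984PropagatorsI,
(1.110) p.35; CombesThomas1973, §II] [folklore] -/
theorem exists_green_lap_every_mass
    (hT : ∀ x y, T x y = if x = y then 2 * d + m ^ 2 else if l1 (x - y) = 1 then -1 else 0) (hm : m ≠ 0) :
    ∃ κ : ℝ, 0 < κ ∧ ∃ S : Kernel₂ d, compKer T S = kdelta ∧ compKer S T = kdelta ∧ Decay₂ S (2 / m ^ 2) κ ∧
      ∀ n : ℕ, IsPeriodic₂ n S := by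
  obtain ⟨hκ, hle⟩ := rate_lap (d := d) hm
  have hm2 : 0 < m ^ 2 := by positivity
  have hρ : 2 * d * (Real.exp (Real.log (1 + m ^ 2 / (4 * d + 4))) - 1) < m ^ 2 := by linarith
  obtain ⟨S, h1, h2, h3, h4⟩ := exists_green_lap hT hκ hρ
  refine ⟨_, hκ, S, h1, h2, decay₂_mono h3 ?_, h4⟩
  calc (m ^ 2 - 2 * d * (Real.exp (Real.log (1 + m ^ 2 / (4 * d + 4))) - 1))⁻¹ ≤ (m ^ 2 / 2)⁻¹ :=
        inv_anti₀ (by positivity) (by linarith)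
    _ = 2 / m ^ 2 := inv_div _ _

end Yukawa

end Literature.MathematicalPhysics.QuantumFieldTheory.Balaban1983to89.Beta.RemainderKernelGreenLattice
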